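import Literature.NumberTheory.EllipticCurves.SerreOpenImageDeterminantProofs
import Literature.NumberTheory.EllipticCurves.IrreducibleModPQuadraticTwistProofs
import Literature.NumberTheory.EllipticCurves.VariableChangePointsMap
import HarnessLib

/-!
# Route `KolyvaginDepthDoor`, crux `KolyvaginDepthSupplyKN` (stmt-BirchSwinnertonDyer-22820) —
# GENERIC: surjectivity of `ρ̄_{E,p}` is invariant under quadratic twists (and changes of equation) over `ℚ`

Helper file of the lead prover of line `levelone` (kdd-p1 g19; `--supports stmt-BirchSwinnertonDyer-22820
--as helper`); it closes nothing and BSD is NOT proved by it. (Generic; a librarian may re-home it next to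
`Literature/NumberTheory/EllipticCurves/IrreducibleModPQuadraticTwistProofs.lean`, whose IRREDUCIBILITY analogue it completes.)

The depth table's even-rank rows (v15) certify `ρ̄_{T,p}` onto for each Heegner twist `T` by three Serre witnesses. The reason this
works uniformly is a one-line fact: `E^{(d)}[p] ≅ E[p] ⊗ χ_d`, and multiplying a surjective `ρ̄ : Γ_ℚ ↠ Aut(E[p])` by a sign does
not lose surjectivity. Proof without group theory of `GL₂(𝔽_p)`: let `e : E'[p] ≃+ E[p]` be `Γ_ℚ`-equivariant UP TO A SIGN
`ε(σ)` (uniform in the point), and pick `g₀ ∈ Aut(E[p])` with `g₀² = −1` (a rotation in an additive frame `E[p] ≃+ 𝔽_p²`,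
`exists_frame_galoisRepTorsion_rat`). Given `h' ∈ Aut(E'[p])`, choose `σ` with `ρ̄_E(σ) = e h' e⁻¹` and `σ₀` with `ρ̄_E(σ₀) = g₀`
(surjectivity); then `ρ̄_{E'}(σ) = h'` if `ε(σ) = +1`, and `ρ̄_{E'}(σ₀² σ) = h'` if `ε(σ) = −1` (`ε(σ₀)² = 1`, `g₀² = −1`).

* `hasSurjectiveModNGaloisRep_of_addEquiv_signed` — the abstract statement (any prime `p`, `W` elliptic over `ℚ`).
* `hasSurjectiveModNGaloisRep_quadraticTwist` — `ρ̄_{E,p}` onto ⟹ `ρ̄_{E^{(d)},p}` onto (`d ≠ 0`), via the tree's signed twist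
  isomorphism `exists_addEquiv_geomPoints_quadraticTwist_signed` restricted to `p`-torsion.
* `hasSurjectiveModNGaloisRep_smul` / `hasSurjectiveModNGaloisRep_of_smul_eq_quadraticTwist` — transport along a change of
  Weierstrass equation (`VariableChange.pointEquivBaseChange`, exactly equivariant), hence to any model `W'` with
  `C • W' = W.quadraticTwist d` — the form the depth-table rows use (`minTwist<D>_smul_eq`).

UNCONDITIONAL (no named fact). Consequence for the instrument: the twist's surjectivity certificate at `p` follows from the curve's
(`hasSurjectiveModNGaloisRep_pow_5 1`) for EVERY row at once, and at every admissible `p` — the first of the two generic inputs a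
`p`-uniform even-rank row needs (the other is `a_p(E^{(d)}) = χ_d(p)·a_p(E)` for ordinarity). BSD is NOT proved by it.

References: [SilvermanAEC2009] X.5 Cor. 5.4, III.§7; [Serre1972] §4.
-/

set_option linter.dupNamespace false

noncomputable section

open scoped Classical Matrix

namespace Summit.BirchSwinnertonDyer.BirchSwinnertonDyer.Theorems.KolyvaginDepthDoor

open Literature.NumberTheory.EllipticCurves WeierstrassCurve Field

/-- **Surjectivity of the mod-`p` representation transported along a sign-equivariant isomorphism of `p`-torsion groups.**
`W, W'` Weierstrass curves over `ℚ`, `W` elliptic; `e : E'[p] ≃+ E[p]` with, for every `σ ∈ Γ_ℚ`, either `e ∘ σ = σ ∘ e` or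
`e ∘ σ = −σ ∘ e` on all of `E'[p]`. If `ρ̄_{W,p} : Γ_ℚ → Aut(E[p])` is onto, so is `ρ̄_{W',p}`. (A rotation `g₀`, `g₀² = −1`, exists
in `Aut(E[p])` by the additive frame `E[p] ≃+ 𝔽_p²`; if `σ` realises `e h' e⁻¹` with the wrong sign, `σ₀²σ` realises `h'`, where
`σ₀` realises `g₀`.) [cite: SilvermanAEC2009, III.§7 and X.5 Cor. 5.4] -/
theorem hasSurjectiveModNGaloisRep_of_addEquiv_signed (W W' : WeierstrassCurve ℚ) [W.IsElliptic] (p : ℕ) [Fact p.Prime]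
    (e : geomTorsion W' p ≃+ geomTorsion W p)
    (he : ∀ σ : absoluteGaloisGroup ℚ,
      (∀ P, e (σ • P) = σ • e P) ∨ (∀ P, e (σ • P) = -(σ • e P)))
    (h : W.HasSurjectiveModNGaloisRep p) : W'.HasSurjectiveModNGaloisRep p := by
  -- an additive frame of `E[p]` and the rotation `g₀ : P ↦ fr⁻¹ (R · fr P)`, `g₀ (g₀ P) = -P`
  obtain ⟨fr, -⟩ := W.exists_frame_galoisRepTorsion_rat p
  let R : Matrix (Fin 2) (Fin 2) (ZMod p) := !![0, -1; 1, 0]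
  have hRR : R * R = -1 := by
    ext i j
    fin_cases i <;> fin_cases j <;> simp [R, Matrix.mul_apply, Fin.sum_univ_two]
  let g₀ : geomTorsion W p → geomTorsion W p := fun P ↦ fr.symm (R *ᵥ fr P)
  have hg₀ : ∀ P, g₀ (g₀ P) = -P := by
    intro P
    simp only [g₀, AddEquiv.apply_symm_apply, Matrix.mulVec_mulVec, hRR, Matrix.neg_mulVec, Matrix.one_mulVec,
      map_neg, AddEquiv.symm_apply_apply]
  have hg₀add : ∀ P Q, g₀ (P + Q) = g₀ P + g₀ Q := by
    intro P Q
    simp only [g₀, map_add, Matrix.mulVec_add]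
  let g₀A : AddAut (geomTorsion W p) :=
    { toFun := g₀
      invFun := fun P ↦ g₀ (g₀ (g₀ P))
      left_inv := fun P ↦ by
        change g₀ (g₀ (g₀ (g₀ P))) = P
        rw [hg₀, hg₀, neg_neg]
      right_inv := fun P ↦ by
        change g₀ (g₀ (g₀ (g₀ P))) = P
        rw [hg₀, hg₀, neg_neg]
      map_add' := hg₀add }
  -- `σ₀` realising `g₀`
  obtain ⟨σ₀, hσ₀⟩ := h (Multiplicative.ofAdd g₀A)
  have hσ₀P : ∀ P : geomTorsion W p, σ₀ • P = g₀ P := by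
    intro P
    have h1 := galoisRepTorsion_apply W (p : ℤ) σ₀ P
    rw [hσ₀] at h1
    exact h1.symm
  -- `σ₀ ∘ σ₀` acts on `E'[p]` through `e` as `g₀²` whatever the sign `ε(σ₀)`
  have hσ₀σ₀ : ∀ X : geomTorsion W p, e (σ₀ • σ₀ • e.symm X) = -X := by
    intro X
    rcases he σ₀ with h0 | h0
    · rw [h0, h0, e.apply_symm_apply, hσ₀P, hσ₀P, hg₀]
    · rw [h0, h0, e.apply_symm_apply, smul_neg, hσ₀P, hσ₀P, neg_neg, hg₀]
  -- surjectivity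
  intro y
  set h' : AddAut (geomTorsion W' p) := Multiplicative.toAdd y with hh'
  -- the conjugate `t = e ∘ h' ∘ e⁻¹ ∈ Aut(E[p])` and `σ` realising it
  let t : AddAut (geomTorsion W p) := e.symm.trans (h'.trans e)
  obtain ⟨σ, hσ⟩ := h (Multiplicative.ofAdd t)
  have hσP : ∀ Q : geomTorsion W' p, σ • e Q = e (h' Q) := by
    intro Q
    have h1 := galoisRepTorsion_apply W (p : ℤ) σ (e Q)
    rw [hσ] at h1
    change (e.symm.trans (h'.trans e)) (e Q) = σ • e Q at h1
    rw [AddEquiv.trans_apply, AddEquiv.trans_apply, e.symm_apply_apply] at h1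
    exact h1.symm
  -- the realising element, according to the sign of `σ`
  have key : ∃ τ : absoluteGaloisGroup ℚ, ∀ Q : geomTorsion W' p, e (τ • Q) = e (h' Q) := by
    rcases he σ with hs | hs
    · exact ⟨σ, fun Q ↦ by rw [hs, hσP]⟩
    · refine ⟨σ₀ * σ₀ * σ, fun Q ↦ ?_⟩
      rw [mul_smul, mul_smul]
      have h2 : σ • Q = e.symm (-(e (h' Q))) := by
        apply e.injective
        rw [e.apply_symm_apply, hs, hσP]
      rw [h2, hσ₀σ₀, neg_neg]
  obtain ⟨τ, hτ⟩ := key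
  refine ⟨τ, ?_⟩
  apply Multiplicative.toAdd.injective
  rw [← hh']
  ext Q
  have h3 : e ((Multiplicative.toAdd (galoisRepTorsion W' (p : ℤ) τ)) Q) = e (h' Q) := by
    rw [galoisRepTorsion_apply]; exact hτ Q
  exact congrArg Subtype.val (e.injective h3)

/-- Restriction of a sign-equivariant isomorphism of geometric points to the `p`-torsion (the `p`-torsion is characterised
additively, so any additive isomorphism preserves it). [folklore] -/
theorem exists_addEquiv_geomTorsion_signed_of_geomPoints {W W' : WeierstrassCurve ℚ} (p : ℕ)
    (f : geomPoints W' ≃+ geomPoints W)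
    (hf : ∀ σ : absoluteGaloisGroup ℚ, (∀ P, f (σ • P) = σ • f P) ∨ (∀ P, f (σ • P) = -(σ • f P))) :
    ∃ e : geomTorsion W' p ≃+ geomTorsion W p,
      ∀ σ : absoluteGaloisGroup ℚ, (∀ P, e (σ • P) = σ • e P) ∨ (∀ P, e (σ • P) = -(σ • e P)) := by
  have htor : ∀ {P : geomPoints W'}, P ∈ geomTorsion W' p ↔ f P ∈ geomTorsion W p := by
    intro P
    rw [geomTorsion, geomTorsion, AddSubgroup.torsionBy.nsmul_iff, AddSubgroup.torsionBy.nsmul_iff,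
      ← map_nsmul, AddEquiv.map_eq_zero_iff]
  let e : geomTorsion W' p ≃+ geomTorsion W p :=
    { toFun := fun P ↦ ⟨f P, htor.mp P.2⟩
      invFun := fun Q ↦ ⟨f.symm Q, by rw [htor, f.apply_symm_apply]; exact Q.2⟩
      left_inv := fun P ↦ Subtype.ext (f.symm_apply_apply _)
      right_inv := fun Q ↦ Subtype.ext (f.apply_symm_apply _)
      map_add' := fun P Q ↦ Subtype.ext (by
        change f ((P : geomPoints W') + Q) = f P + f Q
        exact map_add f _ _) }
  have he_coe : ∀ P : geomTorsion W' p, ((e P : geomTorsion W p) : geomPoints W) = f P := fun _ ↦ rfl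
  refine ⟨e, fun σ ↦ ?_⟩
  rcases hf σ with hσ | hσ
  · left
    intro P
    exact Subtype.ext (by
      rw [AddSubgroup.torsionBy.coe_smul, he_coe, he_coe, AddSubgroup.torsionBy.coe_smul, hσ])
  · right
    intro P
    exact Subtype.ext (by
      rw [AddSubgroup.coe_neg, AddSubgroup.torsionBy.coe_smul, he_coe, he_coe,
        AddSubgroup.torsionBy.coe_smul, hσ])

/-- **`ρ̄_{E,p}` onto ⟹ `ρ̄_{E^{(d)},p}` onto** (`d ≠ 0`; `E/ℚ` elliptic): the twist isomorphism `E^{(d)}(ℚ̄) ≃+ E(ℚ̄)` is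
`Γ_ℚ`-equivariant up to the sign `σ√d/√d` (`exists_addEquiv_geomPoints_quadraticTwist_signed`, Silverman X.5 Cor. 5.4), and a sign does
not lose surjectivity (`hasSurjectiveModNGaloisRep_of_addEquiv_signed`). [cite: SilvermanAEC2009, X.5 Cor. 5.4] -/
theorem hasSurjectiveModNGaloisRep_quadraticTwist (W : WeierstrassCurve ℚ) [W.IsElliptic] {d : ℚ} (hd : d ≠ 0)
    (p : ℕ) [Fact p.Prime] (h : W.HasSurjectiveModNGaloisRep p) :
    (W.quadraticTwist d).HasSurjectiveModNGaloisRep p := by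
  obtain ⟨f, hf⟩ := W.exists_addEquiv_geomPoints_quadraticTwist_signed hd
  obtain ⟨e, he⟩ := exists_addEquiv_geomTorsion_signed_of_geomPoints (W := W) (W' := W.quadraticTwist d) p f hf
  exact hasSurjectiveModNGaloisRep_of_addEquiv_signed W (W.quadraticTwist d) p e he h

/-- **`ρ̄_{E,p}` onto is invariant under a change of Weierstrass equation**: `V` elliptic over `ℚ` with `ρ̄_{V,p}` onto ⟹ the same
for `C • V` (the bijection `V(ℚ̄) ≃+ (C • V)(ℚ̄)` of `VariableChange.pointEquivBaseChange` is `Γ_ℚ`-equivariant, Silverman III.3.1 (b)).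
[cite: SilvermanAEC2009, III.3.1(b)] -/
theorem hasSurjectiveModNGaloisRep_smul (V : WeierstrassCurve ℚ) [V.IsElliptic] (C : VariableChange ℚ)
    (p : ℕ) [Fact p.Prime] (h : V.HasSurjectiveModNGaloisRep p) :
    (C • V).HasSurjectiveModNGaloisRep p := by
  let e₀ : geomPoints V ≃+ geomPoints (C • V) := VariableChange.pointEquivBaseChange V C (AlgebraicClosure ℚ)
  have hsmul : ∀ (σ : absoluteGaloisGroup ℚ) (P : geomPoints V), e₀ (σ • P) = σ • e₀ P := fun σ P ↦
    VariableChange.pointEquivBaseChange_map_algEquiv V C (absoluteGaloisGroup.toAlgEquiv ℚ σ) P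
  have hf : ∀ σ : absoluteGaloisGroup ℚ, (∀ P, e₀.symm (σ • P) = σ • e₀.symm P) ∨
      (∀ P, e₀.symm (σ • P) = -(σ • e₀.symm P)) := by
    intro σ
    left
    intro P
    apply e₀.injective
    rw [e₀.apply_symm_apply, hsmul, e₀.apply_symm_apply]
  obtain ⟨e, he⟩ := exists_addEquiv_geomTorsion_signed_of_geomPoints (W := V) (W' := C • V) p e₀.symm hf
  exact hasSurjectiveModNGaloisRep_of_addEquiv_signed V (C • V) p e he h

/-- **`ρ̄_{E,p}` onto ⟹ `ρ̄_{E',p}` onto for every model `E'` of the quadratic twist** (`C • W' = W.quadraticTwist d`, `d ≠ 0`) — the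
form used by the depth-table rows (`minTwist<D>_smul_eq`): the Serre-witness certificates of `ρ̄_{T,p}` for the Heegner twists follow
from the curve's own surjectivity, at every prime at once. [cite: SilvermanAEC2009, X.5 Cor. 5.4 and III.3.1(b)] -/
theorem hasSurjectiveModNGaloisRep_of_smul_eq_quadraticTwist (W W' : WeierstrassCurve ℚ) [W.IsElliptic] {d : ℚ}
    (hd : d ≠ 0) {C : VariableChange ℚ} (hC : C • W' = W.quadraticTwist d) (p : ℕ) [Fact p.Prime]
    (h : W.HasSurjectiveModNGaloisRep p) : W'.HasSurjectiveModNGaloisRep p := by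
  haveI := W.isElliptic_quadraticTwist hd
  have h1 : (W.quadraticTwist d).HasSurjectiveModNGaloisRep p := hasSurjectiveModNGaloisRep_quadraticTwist W hd p h
  have h2 := hasSurjectiveModNGaloisRep_smul (W.quadraticTwist d) C⁻¹ p h1
  rwa [← hC, inv_smul_smul] at h2

end Summit.BirchSwinnertonDyer.BirchSwinnertonDyer.Theorems.KolyvaginDepthDoor

end
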